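import Literature.Analysis.FluidPDE.CompressibleEulerImplosionCentreSeriesTM
import HarnessLib

/-!
# Buckmaster–Cao-Labora–Gómez-Serrano at `γ = 5/3`: Taylor models of the centre series near the edge of the certified disc

Companion of `…CentreSeriesTM` (Taylor models `tmW m n h`, `tmU m n h` of the six series `fW r m`, `fU r m` in
`ζ = c eˣ`, with the geometric tail `λ^{n+1}hⁿ/(1 − λh)` of the weighted bound `|w_j|(j+1)² ≤ λʲ`, `λ = 73/25`). That
tail is useless near the edge `λh → 1` of the certified disc, which the core envelope of the crux `DenseExcursion`
(line `sonic-cavity-renewal`, clauses (b), (c) of the cavity tube on `x ≤ −1/3`, i.e. `ζ ≤ c e^{−1/3} ≤ 0.33`,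
`λζ ≤ 0.963`) needs. Here ALL sixty certified head coefficients `bndsW2` are used and the tail beyond order `60` is
bounded by the growth lemma `|w_j| ≤ Θλʲ/j³` (`…OriginSeriesGrowth.abs_w_le_growth`, `Θ = 1/400000`):
`tmWe m h`, `tmUe m h` enclose `fW r m`, `fU r m` on `|ζ| ≤ h` for every `λh < 1` (`tmem_fW_edge`, `tmem_fU_edge`),
with tails `Θλ(λh)⁶⁰/(61(1 − λh))` and `Θ(λh)⁶¹/(183(1 − λh))`. No facts, no axioms.

[cite: BuckmasterCaolaboraGomezserrano2025, Prop. 2.5, eq. (2.12), App. B]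
-/

noncomputable section

open Finset

namespace Literature.Analysis.FluidPDE

namespace BuckmasterCaolaboraGomezserrano2025

namespace OriginSeries

namespace CentreW2

open Literature.Analysis.ValidatedNumerics Literature.Analysis.ValidatedNumerics.PolyMP
open Literature.Analysis.ValidatedNumerics.NumericsMP Literature.Analysis.ValidatedNumerics.Numerics

set_option linter.style.longLine false
set_option linter.style.setOption false

/-! ### Kernel side -/

/-- Scaled bound of the tail of `W^{(m)}` beyond order `60`: `Θλ(λh)⁶⁰/(61(1 − λh))`. [folklore] -/
def tailWe (h : ℚ) : ℤ := qceil (thetaQ * lamQ / 61 * (lamQ * h) ^ 60 / (1 - lamQ * h) * SB)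

/-- Scaled bound of the tail of `U_m` beyond order `61`: `Θ(λh)⁶¹/(183(1 − λh))`. [folklore] -/
def tailUe (h : ℚ) : ℤ := qceil (thetaQ / 183 * (lamQ * h) ^ 61 / (1 - lamQ * h) * SB)

/-- The edge Taylor model of `W^{(m)}`: all sixty certified heads, the `Θ`-tail folded into the constant coefficient. [folklore] -/
def tmWe (m : ℕ) (h : ℚ) : IPoly := widen0 (headW m 60) (tailWe h)

/-- The edge Taylor model of `U_m = c·(eˣS)^{(m)}`. [folklore] -/
def tmUe (m : ℕ) (h : ℚ) : IPoly := widen0 (headU m 61) (tailUe h)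

/-! ### Real side -/

variable {r : ℝ}

/-- **Geometric tail estimate from an index on.** [folklore] -/
theorem abs_tsum_sub_sum_le' {f : ℕ → ℝ} {C θ : ℝ} {n : ℕ} (hθ0 : 0 ≤ θ) (hθ1 : θ < 1) (hs : Summable f)
    (hf : ∀ j, n ≤ j → |f j| ≤ C * θ ^ j) : |∑' j, f j - ∑ j ∈ range n, f j| ≤ C * θ ^ n / (1 - θ) := by
  rw [← hs.sum_add_tsum_nat_add n, add_sub_cancel_left]
  have h1 : HasSum (fun j => f (j + n)) (∑' j, f (j + n)) := ((summable_nat_add_iff n).mpr hs).hasSum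
  have h2 : HasSum (fun j => C * θ ^ n * θ ^ j) (C * θ ^ n * (1 - θ)⁻¹) :=
    (hasSum_geometric_of_lt_one hθ0 hθ1).mul_left (C * θ ^ n)
  rw [div_eq_mul_inv]
  refine abs_le_of_hasSum_le h1 h2 fun j => ?_
  calc |f (j + n)| ≤ C * θ ^ (j + n) := hf (j + n) (by omega)
    _ = C * θ ^ n * θ ^ j := by rw [pow_add]; ring

/-- Beyond order `60`: `|j^m a_j| ≤ (Θλ/61)·λʲ` for `m ≤ 2`. [cite: BuckmasterCaolaboraGomezserrano2025, App. B] -/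
theorem abs_cW_le_theta (hr : r ∈ Set.Icc ((13890041/12500000 : ℚ) : ℝ) ((697/625 : ℚ) : ℝ)) {m : ℕ} (hm : m ≤ 2) {j : ℕ} (hj : 60 ≤ j) :
    |cW r m j| ≤ (1 / 400000 : ℝ) * (73 / 25) / 61 * (73 / 25 : ℝ) ^ j := by
  unfold cW aW
  split_ifs
  · have hw := abs_w_le_growth hr (show 60 < j + 1 by omega)
    have hj1 : (61 : ℝ) ≤ ((j + 1 : ℕ) : ℝ) := by exact_mod_cast (show 61 ≤ j + 1 by omega)
    have hpos : (0 : ℝ) < ((j + 1 : ℕ) : ℝ) := by linarith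
    have hjm : ((j ^ m : ℕ) : ℝ) ≤ (((j + 1 : ℕ) : ℝ)) ^ 2 := by
      have h1 : ((j ^ m : ℕ) : ℝ) ≤ ((j + 1) ^ m : ℕ) := by exact_mod_cast Nat.pow_le_pow_left (Nat.le_succ j) m
      have h2 : (((j + 1) ^ m : ℕ) : ℝ) ≤ (((j + 1) ^ 2 : ℕ) : ℝ) := by
        exact_mod_cast Nat.pow_le_pow_right (Nat.succ_pos j) hm
      push_cast at h1 h2 ⊢; linarith
    rw [abs_mul, abs_neg, abs_of_nonneg (by positivity : (0 : ℝ) ≤ ((j ^ m : ℕ) : ℝ))]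
    -- `j^m |w_{j+1}| ≤ (j+1)² Θλ^{j+1}/(j+1)³ = Θλ^{j+1}/(j+1) ≤ Θλ^{j+1}/61`
    have key : (((j + 1 : ℕ) : ℝ)) ^ 2 * ((1 / 400000 : ℝ) * (73 / 25 : ℝ) ^ (j + 1) / (((j + 1 : ℕ) : ℝ)) ^ 3)
        = (1 / 400000 : ℝ) * (73 / 25 : ℝ) ^ (j + 1) / ((j + 1 : ℕ) : ℝ) := by
      field_simp
    calc ((j ^ m : ℕ) : ℝ) * |w r 1 (j + 1)| ≤ (((j + 1 : ℕ) : ℝ)) ^ 2 * ((1 / 400000 : ℝ) * (73 / 25 : ℝ) ^ (j + 1) / (((j + 1 : ℕ) : ℝ)) ^ 3) := by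
          gcongr
      _ = (1 / 400000 : ℝ) * (73 / 25 : ℝ) ^ (j + 1) / ((j + 1 : ℕ) : ℝ) := key
      _ ≤ (1 / 400000 : ℝ) * (73 / 25 : ℝ) ^ (j + 1) / 61 := by gcongr
      _ = _ := by rw [pow_succ]; ring
  · rw [mul_zero, abs_zero]; positivity

/-- Beyond order `61`: `|j^m w_j/3| ≤ (Θ/183)·λʲ` for `m ≤ 2`. [cite: BuckmasterCaolaboraGomezserrano2025, App. B] -/
theorem abs_cU_le_theta (hr : r ∈ Set.Icc ((13890041/12500000 : ℚ) : ℝ) ((697/625 : ℚ) : ℝ)) {m : ℕ} (hm : m ≤ 2) {j : ℕ} (hj : 61 ≤ j) :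
    |cU r m j| ≤ (1 / 400000 : ℝ) / 183 * (73 / 25 : ℝ) ^ j := by
  unfold cU aU
  split_ifs
  · have hw := abs_w_le_growth hr (show 60 < j by omega)
    have hj1 : (61 : ℝ) ≤ (j : ℝ) := by exact_mod_cast hj
    have hpos : (0 : ℝ) < (j : ℝ) := by linarith
    have hjm : ((j ^ m : ℕ) : ℝ) ≤ (j : ℝ) ^ 2 := by
      have h2 : ((j ^ m : ℕ) : ℝ) ≤ ((j ^ 2 : ℕ) : ℝ) := by exact_mod_cast Nat.pow_le_pow_right (by omega) hm
      push_cast at h2 ⊢; exact h2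
    rw [abs_mul, abs_div, abs_of_nonneg (by positivity : (0 : ℝ) ≤ ((j ^ m : ℕ) : ℝ)), abs_of_pos (by norm_num : (0 : ℝ) < 3)]
    have key : (j : ℝ) ^ 2 * ((1 / 400000 : ℝ) * (73 / 25 : ℝ) ^ j / (j : ℝ) ^ 3 / 3) = (1 / 400000 : ℝ) * (73 / 25 : ℝ) ^ j / 3 / (j : ℝ) := by
      field_simp
    calc ((j ^ m : ℕ) : ℝ) * (|w r 1 j| / 3) ≤ (j : ℝ) ^ 2 * ((1 / 400000 : ℝ) * (73 / 25 : ℝ) ^ j / (j : ℝ) ^ 3 / 3) := by gcongr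
      _ = (1 / 400000 : ℝ) * (73 / 25 : ℝ) ^ j / 3 / (j : ℝ) := key
      _ ≤ (1 / 400000 : ℝ) * (73 / 25 : ℝ) ^ j / 3 / 61 := by gcongr
      _ = _ := by ring
  · rw [mul_zero, abs_zero]; positivity

/-- Common core: a Taylor model from the weighted bound (summability) and a sharper bound beyond order `n` (tail). [folklore] -/
theorem tmem_of_coeff_bound_edge {a : ℕ → ℝ} {head : IPoly} {n : ℕ} {h C : ℚ} (h0 : 0 ≤ h) (hlam : lamQ * h < 1) (hC : 0 ≤ C)
    (ha : ∀ j, |a j| ≤ (73 / 25 : ℝ) ^ (j + 1)) (ha' : ∀ j, n ≤ j → |a j| ≤ (C : ℝ) * (73 / 25 : ℝ) ^ j)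
    (hhead : PMem SB ((List.range n).map a) head) :
    TMem SB h (fun ζ => ∑' j, a j * ζ ^ j) (widen0 head (qceil (C * (lamQ * h) ^ n / (1 - lamQ * h) * SB))) := by
  intro ζ hζ
  have hh : ((h : ℚ) : ℝ) < 25 / 73 := by
    have : (((lamQ * h : ℚ)) : ℝ) < 1 := by exact_mod_cast hlam
    rw [lamQ_mul_cast] at this; linarith
  have hθ0 : 0 ≤ 73 / 25 * |ζ| := by positivity
  have hθ1 : 73 / 25 * |ζ| < 1 := by nlinarith [abs_nonneg ζ]
  have hf : ∀ j, |a j * ζ ^ j| ≤ 73 / 25 * (73 / 25 * |ζ|) ^ j := fun j => by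
    rw [abs_mul, abs_pow, mul_pow]
    have := ha j
    rw [pow_succ] at this
    calc |a j| * |ζ| ^ j ≤ (73 / 25 : ℝ) ^ j * (73 / 25) * |ζ| ^ j := by gcongr
      _ = _ := by ring
  obtain ⟨hs, -⟩ := abs_tsum_sub_sum_le hθ0 hθ1 hf n
  have hf' : ∀ j, n ≤ j → |a j * ζ ^ j| ≤ (C : ℝ) * (73 / 25 * |ζ|) ^ j := fun j hj => by
    rw [abs_mul, abs_pow, mul_pow]
    have := ha' j hj
    calc |a j| * |ζ| ^ j ≤ (C : ℝ) * (73 / 25 : ℝ) ^ j * |ζ| ^ j := by gcongr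
      _ = _ := by ring
  have htail := abs_tsum_sub_sum_le' hθ0 hθ1 hs hf'
  set δ : ℝ := ∑' j, a j * ζ ^ j - ∑ j ∈ range n, a j * ζ ^ j with hδ
  have hCR : (0 : ℝ) ≤ (C : ℝ) := by exact_mod_cast hC
  have hδB : |δ| * SB ≤ (qceil (C * (lamQ * h) ^ n / (1 - lamQ * h) * SB) : ℝ) := by
    refine le_trans ?_ (le_qceil _)
    push_cast
    rw [lamQ_cast]
    have hS : (0 : ℝ) ≤ SB := by positivity
    refine mul_le_mul_of_nonneg_right (htail.trans ?_) hS
    have hz : |ζ| ≤ (h : ℝ) := hζ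
    have hden : 0 < 1 - 73 / 25 * (h : ℝ) := by linarith
    have hden' : 0 < 1 - 73 / 25 * |ζ| := by linarith
    rw [div_le_div_iff₀ hden' hden]
    have hp : (73 / 25 * |ζ|) ^ n ≤ (73 / 25 * (h : ℝ)) ^ n := pow_le_pow_left₀ hθ0 (by linarith) n
    have hq : 1 - 73 / 25 * (h : ℝ) ≤ 1 - 73 / 25 * |ζ| := by linarith
    have hpos : (0 : ℝ) ≤ (C : ℝ) * (73 / 25 * (h : ℝ)) ^ n := by positivity
    calc (C : ℝ) * (73 / 25 * |ζ|) ^ n * (1 - 73 / 25 * (h : ℝ)) ≤ (C : ℝ) * (73 / 25 * (h : ℝ)) ^ n * (1 - 73 / 25 * (h : ℝ)) := by gcongr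
      _ ≤ (C : ℝ) * (73 / 25 * (h : ℝ)) ^ n * (1 - 73 / 25 * |ζ|) := by gcongr
  obtain ⟨bs, hbs, hev⟩ := exists_widen0 hhead hδB ζ
  refine ⟨bs, hbs, ?_⟩
  rw [hev, evalR_map_range, hδ]; ring

/-- **Edge enclosure of `W^{(m)}`** (`m ≤ 2`, `λh < 1`). [cite: BuckmasterCaolaboraGomezserrano2025, Prop. 2.5, App. B] -/
theorem tmem_fW_edge (hr : r ∈ Set.Icc ((13890041/12500000 : ℚ) : ℝ) ((697/625 : ℚ) : ℝ)) {m : ℕ} (hm : m ≤ 2)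
    {h : ℚ} (h0 : 0 ≤ h) (hlam : lamQ * h < 1) : TMem SB h (fW r m) (tmWe m h) := by
  have hC : (0 : ℚ) ≤ thetaQ * lamQ / 61 := by unfold thetaQ lamQ; norm_num
  have key := tmem_of_coeff_bound_edge (n := 60) h0 hlam hC (abs_cW_le hr hm) (fun j hj => ?_) (pmem_headW hr m (by norm_num))
  · exact key
  · have := abs_cW_le_theta hr hm hj
    push_cast; rw [thetaQ_cast, lamQ_cast]; exact this

/-- **Edge enclosure of `U_m`** (`m ≤ 2`, `λh < 1`). [cite: BuckmasterCaolaboraGomezserrano2025, Prop. 2.5, App. B] -/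
theorem tmem_fU_edge (hr : r ∈ Set.Icc ((13890041/12500000 : ℚ) : ℝ) ((697/625 : ℚ) : ℝ)) {m : ℕ} (hm : m ≤ 2)
    {h : ℚ} (h0 : 0 ≤ h) (hlam : lamQ * h < 1) : TMem SB h (fU r m) (tmUe m h) := by
  have hC : (0 : ℚ) ≤ thetaQ / 183 := by unfold thetaQ; norm_num
  have key := tmem_of_coeff_bound_edge (n := 61) h0 hlam hC (abs_cU_le hr hm) (fun j hj => ?_) (pmem_headU hr m (by norm_num))
  · exact key
  · have := abs_cU_le_theta hr hm hj
    push_cast; rw [thetaQ_cast]; exact this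

/-- Kernel smoke test of the edge data path: `U₀ > 0` on `[0, 33/100]`. [folklore] -/
theorem tmUe_smoke : posOn SB 0 (tmUe 0 (33 / 100)) 0 (33 / 100) = true := by decide +kernel

end CentreW2

end OriginSeries

end BuckmasterCaolaboraGomezserrano2025

end Literature.Analysis.FluidPDE
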